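import Summits.HodgeConjecture.HodgeConjecture.Theorems.F0P2aL2bHolArchSmooth
import Summits.HodgeConjecture.HodgeConjecture.Theorems.F0P2aL2bSliceContinuous
import Summits.HodgeConjecture.HodgeConjecture.Theorems.H413SpectrumJunction
import Literature.NumberTheory.Automorphic.AutomorphicRepsGLClosureRegularity
import Mathlib.Topology.ContinuousMap.Bounded.Basic
import HarnessLib

/-!
# FLOOR-0 P2a · B4-ARCHIMEDEAN DESK, line 2 `F0_P2aCohIsotypicLine` — support L2B (iii): the `W`-PACKAGE of the `U(𝔤)`-span of the
# coordinates of a holomorphic cotangent form (arch-smooth, Lie-stable, continuous, invariant, `L²`-representable with injective class map)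

Cell hodgecm-mathlib (D-0151), FLOOR 0; crux item H413 = stmt-HodgeConjecture-24833 (route `HCCMUnconditional`); line
`Cruxes/H413/Lines/F0_P2aCohIsotypicLine.lean` (F0P2a-plan (g2), sha16 fe64be0a9875628f), S2⁺ `stub_archOrth_hol` CUT of F0P2a-p01 (LEAD)
`F0/P2a/F0P2a-p01/CUT-S2plus.v1.md`, step 4 «`W(Φ)`» and the hypotheses (W1) arch-smooth, (W3) `W ≤ l2Representable`, (W4) injective class map
of `sig_L2D` / `hsm`, `hbd`, `hrep` of ★ `closure_l2OfForms_exp_invariant_of_analytic` (owner of L2B: F0P2a-p03).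
THEOREMS ONLY (no `def`, no instance, no notation, no named fact, no `sorry`); `--supports stmt-HodgeConjecture-24833`.
HC_CM is proved only modulo the 7 printed citations until rung 0 closes; this file discharges none of them.

## What is proved
* §1 (ANY adelic group datum `𝒢`): the dictionary `invQuot` (★ `AutomorphicForms`) ↔ `toQuotFun` (★ `UnitaryGroupCohomologicalForms`):
  `invQuot_toQuotFun`, `eq_toQuotFun_of_invQuot_eq`; for a CONTINUOUS left-`A_G G(K)`-invariant `Φ` on a COMPACT automorphic quotient:
  `exists_bound_of_continuous` (bounded), `mem_l2Representable_of_continuous` (`Φ ∈ 𝒢.l2Representable μ`, ★ `SpectrumJunction.memLp_toQuotFun`),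
  `eq_zero_of_invQuot_eq_of_toLp_eq_zero` (injective class map, ★ `SpectrumJunction.toLp_toQuotFun_ne_zero`) [BorelJacquet1979, §4.2, §4.6].
* §2 (the CM frame `(L, ι, H, T, hT)`, `Φ ∈ holCotForms`, `ι_∞ = cmArchSection`): for every word `w` in `𝔲(2,1)` and coordinate `j`, the iterated
  Lie derivative `ψ = X₁ ⋯ Xₙ (Φ · j)` along `ι_∞` is arch-smooth (★ `F0P2aL2bHolArchSmooth`), LEFT-`U(H)(L⁺)`-invariant, RIGHT-`K_c`-invariant,
  RIGHT-invariant under the open `K_f` fixing `Φ` (ι_∞ commutes with `K_c` and `U(H)(𝔸_{L⁺,f})`, ★ `F0P2aCmFrameFactorisation`), has continuous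
  `U(2,1)`-slices (= iterated Lie derivatives of the cotangent group function of a HOLOMORPHIC ball function, ★ `F0P2aL2bMatrixChartSmooth`) and is
  therefore CONTINUOUS on `U(H)(𝔸_{L⁺})` (★ `F0P2aL2bSliceContinuous`) — `iterLieDeriv_hol_package`; and the same for the whole ℂ-SPAN `S(Φ)` of these
  functions, which is moreover LIE-STABLE: `span_iterLieDeriv_hol_isArchSmooth / _lieDeriv_mem / _continuous / _leftInvariant / _mul_cmCompactFactor /
  _exists_isOpen_mul_finAdelic`, and on a compact quotient with an automorphic measure `span_iterLieDeriv_hol_le_l2Representable` (W3),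
  `span_iterLieDeriv_hol_injective` (W4), `span_iterLieDeriv_hol_bounded` (`hbd`) [BorelJacquet1979, §1.5, §4.6]; [HarishChandraTAMS1953, §7].

## References
* [BorelJacquet1979] A. Borel, H. Jacquet, Corvallis PSPM 33.1, §1.5, §4.1–4.2, §4.6.  [HarishChandraTAMS1953] Harish-Chandra, Trans. AMS 75, §7.
* Tree: ★ `Theorems/F0P2aL2bHolArchSmooth`, `F0P2aL2bSliceContinuous`, `F0P2aL2bMatrixChartSmooth`, `F0P2aCmFrameFactorisation`, `H413SpectrumJunction`,
  ★ `Automorphic/AutomorphicRepsGLClosureRegularity` (`l2Representable`), `ArchimedeanCalculus` (`archSmooth`), `AutomorphicRepsGLSatakeFlathProofs`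
  (`IsArchSmooth.lieDeriv_add`, `lieDeriv_zero_right`).
-/

set_option autoImplicit false

-- the mandated namespace has the single-problem summit's repeated segment (`HodgeConjecture.HodgeConjecture`)
set_option linter.dupNamespace false

noncomputable section

open scoped Matrix MatrixGroups Topology ContDiff ComplexOrder ENNReal
open MeasureTheory NumberField NumberField.InfinitePlace MulAction
open Literature.Geometry.ComplexHyperbolic Literature.Geometry.ComplexHyperbolic.BallModel
open Literature.NumberTheory.Automorphic Literature.NumberTheory.Automorphic.AutomorphyFactor Literature.NumberTheory.Automorphic.UnitaryGroup
open Literature.NumberTheory.Automorphic.UnitaryGroup.CotangentForms (toQuotFun cmArchSection cmCompactFactor)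
open Literature.AlgebraicGeometry.ShimuraVarieties Literature.AlgebraicGeometry.ShimuraVarieties.BallForms
open Summit.HodgeConjecture.HodgeConjecture.Cruxes.H413.F0P2aCmFrameFactorisation
open Summit.HodgeConjecture.HodgeConjecture.Cruxes.H413.F0P2aL2bMatrixChartSmooth
open Summit.HodgeConjecture.HodgeConjecture.Cruxes.H413.F0P2aL2bHolArchSmooth
open Summit.HodgeConjecture.HodgeConjecture.Cruxes.H413.F0P2aL2bSliceContinuous

namespace Summit.HodgeConjecture.HodgeConjecture.Cruxes.H413.F0P2aL2bHolLieSpanPackage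

/-! ## §1 Continuous left-invariant functions on a compact automorphic quotient: bounded, `L²`-representable, injective class map -/

section Quotient

variable {K : Type} [Field K] [NumberField K] {𝒢 : AdelicGroupData.{0} K} {μ : Measure 𝒢.automorphicQuotient}

/-- `invQuot (toQuotFun Φ) = Φ` for `Φ` left-invariant under `A_G · G(K)` (the two dictionaries are inverse). [cite: BorelJacquet1979, §4.2] -/
theorem invQuot_toQuotFun {Φ : 𝒢.Adelic → ℂ} (hΦ : ∀ γ ∈ 𝒢.quotientSubgroup, ∀ g, Φ (γ * g) = Φ g) :
    invQuot 𝒢 (toQuotFun 𝒢 Φ) = Φ := by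
  funext g
  rw [invQuot_apply, SpectrumJunction.apply_eq_toQuotFun hΦ g]

/-- A representative `f` with `invQuot f = Φ` IS `toQuotFun Φ` (the quotient map is surjective; no hypothesis on `Φ`). [cite: BorelJacquet1979, §4.2] -/
theorem eq_toQuotFun_of_invQuot_eq {Φ : 𝒢.Adelic → ℂ} {f : 𝒢.automorphicQuotient → ℂ} (h : invQuot 𝒢 f = Φ) : f = toQuotFun 𝒢 Φ := by
  funext x
  rw [← h]
  show f x = f (𝒢.toAutomorphicQuotient ((Quotient.out (x : 𝒢.Adelic ⧸ 𝒢.quotientSubgroup) : 𝒢.Adelic)⁻¹)⁻¹)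
  rw [inv_inv]
  exact congrArg f (QuotientGroup.out_eq' (x : 𝒢.Adelic ⧸ 𝒢.quotientSubgroup)).symm

/-- **Bounded**: a continuous left-invariant function on `G(𝔸_K)` with COMPACT automorphic quotient is bounded (it factors through the quotient).
[cite: BorelJacquet1979, §4.2] -/
theorem exists_bound_of_continuous [CompactSpace 𝒢.automorphicQuotient] {Φ : 𝒢.Adelic → ℂ}
    (hΦ : ∀ γ ∈ 𝒢.quotientSubgroup, ∀ g, Φ (γ * g) = Φ g) (hc : Continuous Φ) : ∃ C : ℝ, ∀ g, ‖Φ g‖ ≤ C := by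
  let F : BoundedContinuousFunction 𝒢.automorphicQuotient ℂ :=
    BoundedContinuousFunction.mkOfCompact ⟨toQuotFun 𝒢 Φ, SpectrumJunction.continuous_toQuotFun hΦ hc⟩
  refine ⟨‖F‖, fun g => ?_⟩
  rw [SpectrumJunction.apply_eq_toQuotFun hΦ g]
  exact F.norm_coe_le_norm (𝒢.toAutomorphicQuotient g⁻¹)

/-- **(W3) `L²`-representable**: a continuous left-invariant `Φ` with compact quotient is `invQuot f` for the `ℒ²`-function `f = toQuotFun Φ`
(finite measure), i.e. `Φ ∈ 𝒢.l2Representable μ`. [cite: BorelJacquet1979, §4.6] -/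
theorem mem_l2Representable_of_continuous [CompactSpace 𝒢.automorphicQuotient] [IsFiniteMeasure μ] {Φ : 𝒢.Adelic → ℂ}
    (hΦ : ∀ γ ∈ 𝒢.quotientSubgroup, ∀ g, Φ (γ * g) = Φ g) (hc : Continuous Φ) : Φ ∈ 𝒢.l2Representable μ :=
  ⟨toQuotFun 𝒢 Φ, SpectrumJunction.memLp_toQuotFun hΦ hc 2, invQuot_toQuotFun hΦ⟩

/-- **(W4) injective class map** in the binder shape of `sig_L2D`: for a continuous left-invariant `Φ` and a measure positive on opens,
`invQuot f = Φ → [f] = 0 → Φ = 0`. [cite: BorelJacquet1979, §4.6] -/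
theorem eq_zero_of_invQuot_eq_of_toLp_eq_zero [μ.IsOpenPosMeasure] {Φ : 𝒢.Adelic → ℂ}
    (hΦ : ∀ γ ∈ 𝒢.quotientSubgroup, ∀ g, Φ (γ * g) = Φ g) (hc : Continuous Φ)
    (f : 𝒢.automorphicQuotient → ℂ) (hf : MemLp f 2 μ) (h : invQuot 𝒢 f = Φ) (h0 : hf.toLp f = 0) : Φ = 0 := by
  obtain rfl := eq_toQuotFun_of_invQuot_eq h
  by_contra hne
  exact SpectrumJunction.toLp_toQuotFun_ne_zero hΦ hc hf hne h0

end Quotient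

/-! ## §2 The CM frame: the `U(𝔤)`-span of the coordinates of a holomorphic cotangent form -/

section CM

variable {L : Type} [Field L] [NumberField L] [IsCMField L] {ι : L →+* ℂ} {H : Matrix (Fin 3) (Fin 3) L} {T : GL (Fin 3) ℂ}
  {hT : (T : Matrix (Fin 3) (Fin 3) ℂ)ᴴ * H.map ι * (T : Matrix (Fin 3) (Fin 3) ℂ) = Literature.Geometry.ComplexHyperbolic.BallModel.J}
  {Φ : (adelicGroupData (↥(maximalRealSubfield L)) L (IsCMField.complexConj L) 3 H).Adelic → (Fin 2 → ℂ)}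

/-- **The generator package.**  For `Φ ∈ holCotForms` of the CM frame, a word `w` in `𝔲(2,1)` and a coordinate `j`, the iterated Lie derivative
`ψ = iterLieDeriv cmArchSection w (Φ · j)` is: (1) arch-smooth, (2) left-`U(H)(L⁺)`-invariant, (3) right-`K_c`-invariant, (4) right-invariant under every
`k ∈ U(H)(𝔸_{L⁺,f})` fixing `Φ`, (5) slice-continuous, (6) CONTINUOUS on `U(H)(𝔸_{L⁺})`. [cite: BorelJacquet1979, §1.5 and §4.2] [cite: Borel1997, §5.14] -/
theorem iterLieDeriv_hol_package
    (hΦ : Φ ∈ CotangentForms.holCotForms (↥(maximalRealSubfield L)) L (IsCMField.complexConj L) 3 H (cmArchSection L ι H T hT)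
      (cmCompactFactor L ι H T hT)) (w : List u21Group.lie) (j : Fin 2) :
    IsArchSmooth (H := u21Group) (cmArchSection L ι H T hT) (iterLieDeriv (H := u21Group) (cmArchSection L ι H T hT) w fun x => Φ x j) ∧
    (∀ γ ∈ (adelicGroupData (↥(maximalRealSubfield L)) L (IsCMField.complexConj L) 3 H).quotientSubgroup, ∀ y,
      iterLieDeriv (H := u21Group) (cmArchSection L ι H T hT) w (fun x => Φ x j) (γ * y) = iterLieDeriv (H := u21Group) (cmArchSection L ι H T hT) w (fun x => Φ x j) y) ∧
    (∀ k ∈ cmCompactFactor L ι H T hT, ∀ y,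
      iterLieDeriv (H := u21Group) (cmArchSection L ι H T hT) w (fun x => Φ x j) (y * k) = iterLieDeriv (H := u21Group) (cmArchSection L ι H T hT) w (fun x => Φ x j) y) ∧
    (∀ k : finAdelic (↥(maximalRealSubfield L)) L (IsCMField.complexConj L) 3 H,
      CotangentForms.rightRep (↥(maximalRealSubfield L)) L (IsCMField.complexConj L) 3 H k Φ = Φ → ∀ y,
      iterLieDeriv (H := u21Group) (cmArchSection L ι H T hT) w (fun x => Φ x j)
          (y * finAdelicToAdelic (↥(maximalRealSubfield L)) L (IsCMField.complexConj L) 3 H k) =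
        iterLieDeriv (H := u21Group) (cmArchSection L ι H T hT) w (fun x => Φ x j) y) ∧
    (∀ y, Continuous fun u : ↥U21 => iterLieDeriv (H := u21Group) (cmArchSection L ι H T hT) w (fun x => Φ x j) (y * cmArchSection L ι H T hT u)) ∧
    Continuous (iterLieDeriv (H := u21Group) (cmArchSection L ι H T hT) w fun x => Φ x j) := by
  obtain ⟨hW, hK, hS, hH⟩ := CotangentForms.mem_holCotForms_iff.1 hΦ
  -- (2) left invariance, (3) `K_c`, (4) `K_f`
  have hleft : ∀ γ ∈ (adelicGroupData (↥(maximalRealSubfield L)) L (IsCMField.complexConj L) 3 H).quotientSubgroup, ∀ y,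
      iterLieDeriv (H := u21Group) (cmArchSection L ι H T hT) w (fun x => Φ x j) (γ * y) = iterLieDeriv (H := u21Group) (cmArchSection L ι H T hT) w (fun x => Φ x j) y :=
    fun γ hγ => iterLieDeriv_apply_mul_left (cmArchSection L ι H T hT) w
      (fun y => by simp only [SpectrumJunction.leftInvariant_of_mem_holCotForms hΦ γ hγ y])
  have hKc : ∀ k ∈ cmCompactFactor L ι H T hT, ∀ y,
      iterLieDeriv (H := u21Group) (cmArchSection L ι H T hT) w (fun x => Φ x j) (y * k) = iterLieDeriv (H := u21Group) (cmArchSection L ι H T hT) w (fun x => Φ x j) y :=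
    fun k hk => iterLieDeriv_apply_mul_right_of_forall_commute (cmArchSection L ι H T hT) w
      (fun u => cmArchSection_mul_of_mem_cmCompactFactor L ι H T hT u hk) (fun y => by simp only [hK k hk y])
  have hKf : ∀ k : finAdelic (↥(maximalRealSubfield L)) L (IsCMField.complexConj L) 3 H,
      CotangentForms.rightRep (↥(maximalRealSubfield L)) L (IsCMField.complexConj L) 3 H k Φ = Φ → ∀ y,
      iterLieDeriv (H := u21Group) (cmArchSection L ι H T hT) w (fun x => Φ x j)
          (y * finAdelicToAdelic (↥(maximalRealSubfield L)) L (IsCMField.complexConj L) 3 H k) =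
        iterLieDeriv (H := u21Group) (cmArchSection L ι H T hT) w (fun x => Φ x j) y := by
    intro k hk
    refine iterLieDeriv_apply_mul_right_of_forall_commute (cmArchSection L ι H T hT) w
      (fun u => cmArchSection_mul_finAdelicToAdelic L ι H T hT u k) fun y => ?_
    have e := congrFun hk y
    rw [CotangentForms.rightRep_apply] at e
    simp only [e]
  -- (5) slice continuity: the slice at `y` is the iterated Lie derivative of the cotangent group function of a holomorphic ball function
  have hslice : ∀ y, Continuous fun u : ↥U21 =>
      iterLieDeriv (H := u21Group) (cmArchSection L ι H T hT) w (fun x => Φ x j) (y * cmArchSection L ι H T hT u) := by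
    intro y
    obtain ⟨Fb, hFb, heq⟩ := exists_mem_holomorphic_slice_eq (cmArchSection L ι H T hT) hW hH y
    have e : (fun u : ↥U21 => Φ (y * cmArchSection L ι H T hT u) j) = fun u => toGroupFun BallForms.cotangentCocycle x₀ Fb u j := by
      funext u
      exact congrFun (congrFun heq u) j
    rw [← iterLieDeriv_slice (cmArchSection L ι H T hT) w (fun x => Φ x j) y, e]
    exact continuous_iterLieDeriv_toGroupFun_of_mem_holomorphic hFb j w
  -- (6) continuity on the adelic group
  obtain ⟨Kf, hKo, hKfΦ⟩ := exists_isOpen_forall_rightRep_eq hS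
  refine ⟨isArchSmooth_iterLieDeriv_apply_of_mem_holCotForms_cm L ι H T hT hΦ j w, hleft, hKc, hKf, hslice, ?_⟩
  exact continuous_of_continuous_cmSlice L ι H T hT _ hslice hKc ⟨Kf, hKo, fun k hk => hKf k (hKfΦ k hk)⟩

/-- **`S(Φ)` is arch-smooth (W1)**: every element of the ℂ-span of the iterated Lie derivatives of the coordinates of `Φ ∈ holCotForms` is `IsArchSmooth`
along `cmArchSection`. [cite: BorelJacquet1979, §1.5] -/
theorem span_iterLieDeriv_hol_isArchSmooth
    (hΦ : Φ ∈ CotangentForms.holCotForms (↥(maximalRealSubfield L)) L (IsCMField.complexConj L) 3 H (cmArchSection L ι H T hT)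
      (cmCompactFactor L ι H T hT)) {ψ : (adelicGroupData (↥(maximalRealSubfield L)) L (IsCMField.complexConj L) 3 H).Adelic → ℂ}
    (hψ : ψ ∈ Submodule.span ℂ (Set.range fun p : List u21Group.lie × Fin 2 =>
      iterLieDeriv (H := u21Group) (cmArchSection L ι H T hT) p.1 fun x => Φ x p.2)) :
    IsArchSmooth (H := u21Group) (cmArchSection L ι H T hT) ψ := by
  rw [← mem_archSmooth_iff]
  refine (Submodule.span_le.2 ?_) hψ
  rintro _ ⟨p, rfl⟩
  exact (mem_archSmooth_iff _ _).2 (iterLieDeriv_hol_package hΦ p.1 p.2).1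

/-- **`S(Φ)` is LIE-STABLE (W2 for `S(Φ)` itself)**: `X ψ ∈ S(Φ)` for `ψ ∈ S(Φ)`, `X ∈ 𝔲(2,1)` (a generator goes to the generator of the longer word;
the Lie derivative is ℂ-linear on arch-smooth functions). [cite: BorelJacquet1979, §1.5] -/
theorem span_iterLieDeriv_hol_lieDeriv_mem
    (hΦ : Φ ∈ CotangentForms.holCotForms (↥(maximalRealSubfield L)) L (IsCMField.complexConj L) 3 H (cmArchSection L ι H T hT)
      (cmCompactFactor L ι H T hT)) (X : u21Group.lie)
    {ψ : (adelicGroupData (↥(maximalRealSubfield L)) L (IsCMField.complexConj L) 3 H).Adelic → ℂ}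
    (hψ : ψ ∈ Submodule.span ℂ (Set.range fun p : List u21Group.lie × Fin 2 =>
      iterLieDeriv (H := u21Group) (cmArchSection L ι H T hT) p.1 fun x => Φ x p.2)) :
    lieDeriv (H := u21Group) (cmArchSection L ι H T hT) X ψ ∈ Submodule.span ℂ (Set.range fun p : List u21Group.lie × Fin 2 =>
      iterLieDeriv (H := u21Group) (cmArchSection L ι H T hT) p.1 fun x => Φ x p.2) := by
  induction hψ using Submodule.span_induction with
  | mem x hx =>
    obtain ⟨p, rfl⟩ := hx
    refine Submodule.subset_span ⟨(X :: p.1, p.2), ?_⟩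
    simp only [iterLieDeriv_cons]
  | zero =>
    rw [lieDeriv_zero_right]
    exact Submodule.zero_mem _
  | add x y hx hy ihx ihy =>
    rw [IsArchSmooth.lieDeriv_add (H := u21Group) (cmArchSection L ι H T hT) X (span_iterLieDeriv_hol_isArchSmooth hΦ hx)
      (span_iterLieDeriv_hol_isArchSmooth hΦ hy)]
    exact Submodule.add_mem _ ihx ihy
  | smul c x hx ihx =>
    rw [lieDeriv_smul]
    exact Submodule.smul_mem _ c ihx

/-- **`S(Φ)` consists of CONTINUOUS, LEFT-invariant, right-`K_c`-invariant functions, right-invariant under ONE open `K_f ≤ U(H)(𝔸_{L⁺,f})`.**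
[cite: BorelJacquet1979, §1.5 and §4.2] -/
theorem span_iterLieDeriv_hol_regular
    (hΦ : Φ ∈ CotangentForms.holCotForms (↥(maximalRealSubfield L)) L (IsCMField.complexConj L) 3 H (cmArchSection L ι H T hT)
      (cmCompactFactor L ι H T hT)) :
    ∃ Kf : Subgroup (finAdelic (↥(maximalRealSubfield L)) L (IsCMField.complexConj L) 3 H),
      IsOpen (Kf : Set (finAdelic (↥(maximalRealSubfield L)) L (IsCMField.complexConj L) 3 H)) ∧
      ∀ ψ ∈ Submodule.span ℂ (Set.range fun p : List u21Group.lie × Fin 2 => iterLieDeriv (H := u21Group) (cmArchSection L ι H T hT) p.1 fun x => Φ x p.2),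
        Continuous ψ ∧
        (∀ γ ∈ (adelicGroupData (↥(maximalRealSubfield L)) L (IsCMField.complexConj L) 3 H).quotientSubgroup, ∀ y, ψ (γ * y) = ψ y) ∧
        (∀ k ∈ cmCompactFactor L ι H T hT, ∀ y, ψ (y * k) = ψ y) ∧
        (∀ k ∈ Kf, ∀ y, ψ (y * finAdelicToAdelic (↥(maximalRealSubfield L)) L (IsCMField.complexConj L) 3 H k) = ψ y) := by
  obtain ⟨-, -, hS, -⟩ := CotangentForms.mem_holCotForms_iff.1 hΦ
  obtain ⟨Kf, hKo, hKfΦ⟩ := exists_isOpen_forall_rightRep_eq hS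
  refine ⟨Kf, hKo, fun ψ hψ => ?_⟩
  -- the regular functions form a submodule containing the generators
  let R : Submodule ℂ ((adelicGroupData (↥(maximalRealSubfield L)) L (IsCMField.complexConj L) 3 H).Adelic → ℂ) :=
    { carrier := {ψ | Continuous ψ ∧
        (∀ γ ∈ (adelicGroupData (↥(maximalRealSubfield L)) L (IsCMField.complexConj L) 3 H).quotientSubgroup, ∀ y, ψ (γ * y) = ψ y) ∧
        (∀ k ∈ cmCompactFactor L ι H T hT, ∀ y, ψ (y * k) = ψ y) ∧
        (∀ k ∈ Kf, ∀ y, ψ (y * finAdelicToAdelic (↥(maximalRealSubfield L)) L (IsCMField.complexConj L) 3 H k) = ψ y)}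
      zero_mem' := ⟨continuous_const, fun _ _ _ => rfl, fun _ _ _ => rfl, fun _ _ _ => rfl⟩
      add_mem' := fun {a b} ha hb => ⟨ha.1.add hb.1, fun γ hγ y => by simp only [Pi.add_apply, ha.2.1 γ hγ y, hb.2.1 γ hγ y],
        fun k hk y => by simp only [Pi.add_apply, ha.2.2.1 k hk y, hb.2.2.1 k hk y],
        fun k hk y => by simp only [Pi.add_apply, ha.2.2.2 k hk y, hb.2.2.2 k hk y]⟩
      smul_mem' := fun c a ha => ⟨continuous_const.mul ha.1, fun γ hγ y => by simp only [Pi.smul_apply, ha.2.1 γ hγ y],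
        fun k hk y => by simp only [Pi.smul_apply, ha.2.2.1 k hk y],
        fun k hk y => by simp only [Pi.smul_apply, ha.2.2.2 k hk y]⟩ }
  have hle : Submodule.span ℂ (Set.range fun p : List u21Group.lie × Fin 2 =>
      iterLieDeriv (H := u21Group) (cmArchSection L ι H T hT) p.1 fun x => Φ x p.2) ≤ R := by
    refine Submodule.span_le.2 ?_
    rintro _ ⟨p, rfl⟩
    obtain ⟨-, h2, h3, h4, -, h6⟩ := iterLieDeriv_hol_package hΦ p.1 p.2
    exact ⟨h6, h2, h3, fun k hk => h4 k (hKfΦ k hk)⟩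
  exact hle hψ

variable {μ : Measure (adelicGroupData (↥(maximalRealSubfield L)) L (IsCMField.complexConj L) 3 H).automorphicQuotient}

/-- **(W3) for `S(Φ)`**: on a COMPACT automorphic quotient with a finite measure, `S(Φ) ≤ l2Representable μ`. [cite: BorelJacquet1979, §4.6] -/
theorem span_iterLieDeriv_hol_le_l2Representable
    [CompactSpace (adelicGroupData (↥(maximalRealSubfield L)) L (IsCMField.complexConj L) 3 H).automorphicQuotient] [IsFiniteMeasure μ]
    (hΦ : Φ ∈ CotangentForms.holCotForms (↥(maximalRealSubfield L)) L (IsCMField.complexConj L) 3 H (cmArchSection L ι H T hT)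
      (cmCompactFactor L ι H T hT)) :
    Submodule.span ℂ (Set.range fun p : List u21Group.lie × Fin 2 => iterLieDeriv (H := u21Group) (cmArchSection L ι H T hT) p.1 fun x => Φ x p.2) ≤
      (adelicGroupData (↥(maximalRealSubfield L)) L (IsCMField.complexConj L) 3 H).l2Representable μ := by
  obtain ⟨Kf, -, hR⟩ := span_iterLieDeriv_hol_regular hΦ
  intro ψ hψ
  obtain ⟨hc, hl, -, -⟩ := hR ψ hψ
  exact mem_l2Representable_of_continuous hl hc

/-- **(W4) for `S(Φ)`** (measure positive on non-empty open sets, e.g. automorphic): the class map is injective on `S(Φ)`, in the binder shape of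
`sig_L2D`. [cite: BorelJacquet1979, §4.6] -/
theorem span_iterLieDeriv_hol_injective [μ.IsOpenPosMeasure]
    (hΦ : Φ ∈ CotangentForms.holCotForms (↥(maximalRealSubfield L)) L (IsCMField.complexConj L) 3 H (cmArchSection L ι H T hT)
      (cmCompactFactor L ι H T hT))
    {ψ : (adelicGroupData (↥(maximalRealSubfield L)) L (IsCMField.complexConj L) 3 H).Adelic → ℂ}
    (hψ : ψ ∈ Submodule.span ℂ (Set.range fun p : List u21Group.lie × Fin 2 => iterLieDeriv (H := u21Group) (cmArchSection L ι H T hT) p.1 fun x => Φ x p.2))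
    (f : (adelicGroupData (↥(maximalRealSubfield L)) L (IsCMField.complexConj L) 3 H).automorphicQuotient → ℂ) (hf : MemLp f 2 μ)
    (h : invQuot (adelicGroupData (↥(maximalRealSubfield L)) L (IsCMField.complexConj L) 3 H) f = ψ) (h0 : hf.toLp f = 0) : ψ = 0 := by
  obtain ⟨Kf, -, hR⟩ := span_iterLieDeriv_hol_regular hΦ
  obtain ⟨hc, hl, -, -⟩ := hR ψ hψ
  exact eq_zero_of_invQuot_eq_of_toLp_eq_zero hl hc f hf h h0

/-- **`hbd` for `S(Φ)`**: on a compact automorphic quotient every element of `S(Φ)` is bounded. [cite: BorelJacquet1979, §4.2] -/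
theorem span_iterLieDeriv_hol_bounded
    [CompactSpace (adelicGroupData (↥(maximalRealSubfield L)) L (IsCMField.complexConj L) 3 H).automorphicQuotient]
    (hΦ : Φ ∈ CotangentForms.holCotForms (↥(maximalRealSubfield L)) L (IsCMField.complexConj L) 3 H (cmArchSection L ι H T hT)
      (cmCompactFactor L ι H T hT))
    {ψ : (adelicGroupData (↥(maximalRealSubfield L)) L (IsCMField.complexConj L) 3 H).Adelic → ℂ}
    (hψ : ψ ∈ Submodule.span ℂ (Set.range fun p : List u21Group.lie × Fin 2 => iterLieDeriv (H := u21Group) (cmArchSection L ι H T hT) p.1 fun x => Φ x p.2)) :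
    ∃ C : ℝ, ∀ g, ‖ψ g‖ ≤ C := by
  obtain ⟨Kf, -, hR⟩ := span_iterLieDeriv_hol_regular hΦ
  obtain ⟨hc, hl, -, -⟩ := hR ψ hψ
  exact exists_bound_of_continuous hl hc

/-- The coordinates of `Φ` themselves lie in `S(Φ)` (the empty word). [cite: BorelJacquet1979, §1.5] -/
theorem apply_mem_span_iterLieDeriv_hol (j : Fin 2) :
    (fun x => Φ x j) ∈ Submodule.span ℂ (Set.range fun p : List u21Group.lie × Fin 2 =>
      iterLieDeriv (H := u21Group) (cmArchSection L ι H T hT) p.1 fun x => Φ x p.2) :=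
  Submodule.subset_span ⟨([], j), rfl⟩

end CM

end Summit.HodgeConjecture.HodgeConjecture.Cruxes.H413.F0P2aL2bHolLieSpanPackage

end
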